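import Literature.AnabelianGeometry.AbsoluteAnabelian.AbsTopIII.KummerFaithfulRatFuncPadicProofs
import Mathlib.FieldTheory.RatFunc.AsPolynomial
import Mathlib.RingTheory.Algebraic.Basic
import HarnessLib

/-!
# [AbsTopIII] Rmk. 1.5.4 (i): fields of transcendence degree one over `ℚ_p`, intrinsic form

Proof-only companion (no new definitions) to `AbsTopIII/KummerFaithful.lean` (S. Mochizuki, *Topics in
Absolute Anabelian Geometry III*, §1, Def. 1.5 (a) p. 32, Rmk. 1.5.4 (i) p. 33, lit key
`paper:url-5493eb38cbb7`).  The companion `KummerFaithfulFunctionFieldCurveProofs` proves condition (a)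
of Def. 1.5 for abelian varieties over fields `L` presented as finite extensions of `RatFunc ℚ_[p]`.
Here the presentation is removed: for a `ℚ_p`-field `L`, an element `t ∈ L` transcendental over `ℚ_p`
with `L` finite over `ℚ_p(t) = ℚ_[p]⟮t⟯` — i.e. `L` finitely generated of transcendence degree one over
`ℚ_p`, with `{t}` a transcendence basis — every abelian variety over `L` satisfies `⋂_N N · A(L) = {0}`
(`divisibleElementsTrivial_points_of_transcendental`), and `L` is Kummer-faithful
(`isKummerFaithful_of_transcendental`).  The bridge is the evaluation `RatFunc ℚ_[p] → L`, `X ↦ t`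
(Mathlib `RatFunc.liftAlgHom` of `Polynomial.aeval t`, injective since `t` is transcendental), an
isomorphism onto `ℚ_[p]⟮t⟯`.  This is the shape in which the residual hypothesis `hAV` of
`Rmk_1_5_4_i_of_abelianVariety_clause_fg` (FACT-LIST row F-0369) is met at transcendence degree one.
Nothing here bears on [IUTchIII] Cor. 3.12; typed ≠ discharged.
-/

noncomputable section

open scoped Classical Polynomial IntermediateField

namespace Literature.AnabelianGeometry.AbsoluteAnabelian.AbsTopIII

open Polynomial Literature.AlgebraicGeometry.Motives

variable {p : ℕ} [Fact p.Prime] {L : Type} [Field L] [Algebra ℚ_[p] L]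

/-- For `t` transcendental over `ℚ_p`, evaluation `ℚ_p[X] → L`, `X ↦ t`, sends non-zero-divisors to
non-zero-divisors (it is injective). Routine. [cite: MochizukiAbsTopIII2015, Rmk 1.5.4 (i) p.33] -/
theorem nonZeroDivisors_le_comap_aeval {t : L} (ht : Transcendental ℚ_[p] t) :
    nonZeroDivisors ℚ_[p][X] ≤ Submonoid.comap (Polynomial.aeval t : ℚ_[p][X] →ₐ[ℚ_[p]] L)
      (nonZeroDivisors L) := by
  intro q hq
  have hinj : Function.Injective (Polynomial.aeval t : ℚ_[p][X] →ₐ[ℚ_[p]] L) :=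
    transcendental_iff_injective.mp ht
  refine mem_nonZeroDivisors_of_ne_zero fun h => nonZeroDivisors.ne_zero hq (hinj ?_)
  rw [map_zero]
  exact h

/-- The evaluation `ℚ_p(X) → L`, `X ↦ t` (Mathlib `RatFunc.liftAlgHom`) takes values in `ℚ_[p]⟮t⟯`:
a rational function in `t` is a quotient of two polynomials in `t`. [cite: MochizukiAbsTopIII2015, Rmk 1.5.4 (i) p.33] -/
theorem liftAlgHom_aeval_mem_adjoin {t : L} (ht : Transcendental ℚ_[p] t) (f : RatFunc ℚ_[p]) :
    RatFunc.liftAlgHom (Polynomial.aeval t) (nonZeroDivisors_le_comap_aeval ht) f ∈ ℚ_[p]⟮t⟯ := by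
  rw [RatFunc.liftAlgHom_apply]
  have hmem : ∀ q : ℚ_[p][X], (Polynomial.aeval t q : L) ∈ ℚ_[p]⟮t⟯ := fun q =>
    IntermediateField.algebra_adjoin_le_adjoin ℚ_[p] _ (Polynomial.aeval_mem_adjoin_singleton ℚ_[p] t)
  exact div_mem (hmem _) (hmem _)

/-- The evaluation `ℚ_p(X) → L`, `X ↦ t`, maps ONTO `ℚ_[p]⟮t⟯` (its field range contains `t`).
[cite: MochizukiAbsTopIII2015, Rmk 1.5.4 (i) p.33] -/
theorem adjoin_le_fieldRange_liftAlgHom {t : L} (ht : Transcendental ℚ_[p] t) :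
    ℚ_[p]⟮t⟯ ≤ (RatFunc.liftAlgHom (Polynomial.aeval t) (nonZeroDivisors_le_comap_aeval ht)).fieldRange := by
  rw [IntermediateField.adjoin_le_iff]
  intro x hx
  rw [Set.mem_singleton_iff] at hx
  rw [hx, SetLike.mem_coe, AlgHom.mem_fieldRange]
  refine ⟨RatFunc.X, ?_⟩
  rw [RatFunc.liftAlgHom_apply, RatFunc.num_X, RatFunc.denom_X, Polynomial.aeval_X, map_one, div_one]

/-- **Condition (a) of Def. 1.5 for abelian varieties over fields of transcendence degree one over
`ℚ_p`, intrinsic form**: if `t ∈ L` is transcendental over `ℚ_p` and `L` is finite over `ℚ_[p]⟮t⟯`, then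
`⋂_{N ≥ 1} N · A(L) = {0}` for every abelian variety `A / L` ([AbsTopIII] Rmk. 1.5.4 (i) p. 33 at
transcendence degree one; via `divisibleElementsTrivial_points_of_finite_ratFunc_padic` and the
isomorphism `RatFunc ℚ_[p] ≅ ℚ_[p]⟮t⟯`, `X ↦ t`). [cite: MochizukiAbsTopIII2015, Rmk 1.5.4 (i) p.33] -/
theorem divisibleElementsTrivial_points_of_transcendental (t : L) (ht : Transcendental ℚ_[p] t)
    [FiniteDimensional ℚ_[p]⟮t⟯ L] (A : AbelianVariety L) : DivisibleElementsTrivial (A.Points L) := by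
  -- the evaluation maps `φ : ℚ_p[X] → L` and `ψ : ℚ_p(X) → L`
  set φ : ℚ_[p][X] →ₐ[ℚ_[p]] L := Polynomial.aeval t with hφ
  set ψ : RatFunc ℚ_[p] →ₐ[ℚ_[p]] L :=
    RatFunc.liftAlgHom (Polynomial.aeval t) (nonZeroDivisors_le_comap_aeval ht) with hψ
  letI iP : Algebra ℚ_[p][X] L := φ.toRingHom.toAlgebra
  letI iR : Algebra (RatFunc ℚ_[p]) L := ψ.toRingHom.toAlgebra
  haveI : IsScalarTower ℚ_[p][X] (RatFunc ℚ_[p]) L := IsScalarTower.of_algebraMap_eq fun q => by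
    change φ q = ψ (algebraMap ℚ_[p][X] (RatFunc ℚ_[p]) q)
    rw [hψ, RatFunc.liftAlgHom_apply, RatFunc.num_algebraMap, RatFunc.denom_algebraMap, map_one,
      div_one]
  haveI : IsScalarTower ℚ_[p] ℚ_[p][X] L := IsScalarTower.of_algebraMap_eq fun c => by
    change algebraMap ℚ_[p] L c = φ (algebraMap ℚ_[p] ℚ_[p][X] c)
    rw [AlgHom.commutes]
  -- `ψ` is an isomorphism onto `ℚ_[p]⟮t⟯`, so `L` is finite over `ℚ_p(X)` through `ψ`
  have hmem : ∀ f, ψ f ∈ ℚ_[p]⟮t⟯ := liftAlgHom_aeval_mem_adjoin ht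
  let ψ' : RatFunc ℚ_[p] →+* ℚ_[p]⟮t⟯ := (ψ : RatFunc ℚ_[p] →+* L).codRestrict ℚ_[p]⟮t⟯.toSubring hmem
  have hψ'bij : Function.Bijective ψ' := by
    refine ⟨fun f g h => (ψ : RatFunc ℚ_[p] →+* L).injective (congrArg Subtype.val h), fun y => ?_⟩
    obtain ⟨f, hf⟩ := AlgHom.mem_fieldRange.mp (adjoin_le_fieldRange_liftAlgHom ht y.2)
    exact ⟨f, Subtype.ext hf⟩
  let e : RatFunc ℚ_[p] ≃+* ℚ_[p]⟮t⟯ := RingEquiv.ofBijective ψ' hψ'bij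
  haveI : FiniteDimensional (RatFunc ℚ_[p]) L :=
    Module.Finite.of_equiv_equiv (A₁ := ℚ_[p]⟮t⟯) (B₁ := L) (A₂ := RatFunc ℚ_[p]) (B₂ := L)
      e.symm (RingEquiv.refl L) (by
        ext y
        change ψ (e.symm y) = (y : L)
        have h1 : ((e (e.symm y) : ℚ_[p]⟮t⟯) : L) = (y : L) := by rw [e.apply_symm_apply]
        exact h1)
  exact divisibleElementsTrivial_points_of_finite_ratFunc_padic p L A

/-- **A field of transcendence degree one over `ℚ_p` — `t ∈ L` transcendental over `ℚ_p`, `L` finite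
over `ℚ_[p]⟮t⟯` — is Kummer-faithful** ([AbsTopIII] Rmk. 1.5.4 (i) p. 33; this is
`isKummerFaithful_of_finite_ratFunc_padic` transported along the isomorphism `RatFunc ℚ_[p] ≅ ℚ_[p]⟮t⟯`,
`X ↦ t`). [cite: MochizukiAbsTopIII2015, Rmk 1.5.4 (i) p.33] -/
theorem isKummerFaithful_of_transcendental (t : L) (ht : Transcendental ℚ_[p] t)
    [FiniteDimensional ℚ_[p]⟮t⟯ L] : IsKummerFaithful L := by
  set ψ : RatFunc ℚ_[p] →ₐ[ℚ_[p]] L :=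
    RatFunc.liftAlgHom (Polynomial.aeval t) (nonZeroDivisors_le_comap_aeval ht) with hψ
  letI iR : Algebra (RatFunc ℚ_[p]) L := ψ.toRingHom.toAlgebra
  have hmem : ∀ f, ψ f ∈ ℚ_[p]⟮t⟯ := liftAlgHom_aeval_mem_adjoin ht
  let ψ' : RatFunc ℚ_[p] →+* ℚ_[p]⟮t⟯ := (ψ : RatFunc ℚ_[p] →+* L).codRestrict ℚ_[p]⟮t⟯.toSubring hmem
  have hψ'bij : Function.Bijective ψ' := by
    refine ⟨fun f g h => (ψ : RatFunc ℚ_[p] →+* L).injective (congrArg Subtype.val h), fun y => ?_⟩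
    obtain ⟨f, hf⟩ := AlgHom.mem_fieldRange.mp (adjoin_le_fieldRange_liftAlgHom ht y.2)
    exact ⟨f, Subtype.ext hf⟩
  let e : RatFunc ℚ_[p] ≃+* ℚ_[p]⟮t⟯ := RingEquiv.ofBijective ψ' hψ'bij
  haveI : FiniteDimensional (RatFunc ℚ_[p]) L :=
    Module.Finite.of_equiv_equiv (A₁ := ℚ_[p]⟮t⟯) (B₁ := L) (A₂ := RatFunc ℚ_[p]) (B₂ := L)
      e.symm (RingEquiv.refl L) (by
        ext y
        change ψ (e.symm y) = (y : L)
        have h1 : ((e (e.symm y) : ℚ_[p]⟮t⟯) : L) = (y : L) := by rw [e.apply_symm_apply]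
        exact h1)
  exact isKummerFaithful_of_finite_ratFunc_padic p L

end Literature.AnabelianGeometry.AbsoluteAnabelian.AbsTopIII
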